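import Mathlib.NumberTheory.ArithmeticFunction.Moebius
import Mathlib.NumberTheory.ArithmeticFunction.Misc
import Mathlib.Analysis.SpecialFunctions.Pow.Real
import Mathlib.Analysis.SpecialFunctions.Pow.NNReal
import Mathlib.Analysis.SpecialFunctions.Log.Basic
import Mathlib.Data.Nat.Totient
import HarnessLib

/-!
# The local factors `G_α(q)`, `H_α(q)` of the smooth-weighted exponential sums at `a/q`

Topic `Literature/NumberTheory/Sieve`; a PROVED algebraic tool file toward
`Literature.NumberTheory.DiophantineGeometry.XYZUpperHalf` ([Harper2016, Cor. 1], major arcs at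
`a/q`). The principal part of `∑_{n ∈ S(x,y)} e(an/q) w(n/x) e(λn/x)` is
`∑_{g ∣ q} ∑_{d ∣ q/g} μ(q/g) μ(d)/φ(q/g) · S_w(λ; x/(gd))` (`SmoothArcCharacters`), and
`S_w(λ; x/e) ≈ e^{−α} 𝓜 Ŵ_λ(α)` (`SmoothTwistedSaddleRange`); hence the main term `𝓜 Ŵ_λ(α) G_α(q)`
and an error `≪ 𝓜 H_α(q)/(1+|λ|)` with

`G_α(q) = ∑_{g ∣ q} ∑_{d ∣ q/g} μ(q/g) μ(d) (gd)^{−α}/φ(q/g)`,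
`H_α(q) = ∑_{g ∣ q} ∑_{d ∣ q/g} |μ(q/g) μ(d)| (gd)^{−α}/φ(q/g)`.

We prove the closed forms and bounds (`0 ≤ α ≤ 1`, `q ≥ 1`):

* `sum_divisors_moebius_mul_prodPrimeFactors`: `∑_{m ∣ n} μ(m) ∏_{p ∣ m} F(p) = ∏_{p ∣ n} (1 − F(p))`;
* `localG_eq_prod`: `G_α(q) = q^{−α} ∏_{p ∣ q} (p − p^α)/(p − 1)`, so `0 ≤ G_α(q) ≤ q^{−α} ∏_{p∣q} 2(1−α) log p`;
* `localH_eq_prod`: `H_α(q) = q^{−α} ∏_{p ∣ q} (p + p^α)/(p − 1) ≤ 4^{ω(q)} q^{−α}`.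

(`G_α(1) = H_α(1) = 1`; `G_1 ≡ 0` off `q = 1`: complete sums vanish at `a/q`, `q ≥ 2`.)

## References

* A. J. Harper, Compositio Math. 152 (2016), §2.2 (Major Arc Estimate 2: the factor
  `2^{ω(q)} q^{1−α}/φ(q)`) and §5 [Harper2016].
* R. de la Bretèche, Acta Arith. 85 (1998) (local factors of smooth exponential sums) [dlBAA1998].
-/

noncomputable section

open Finset Real ArithmeticFunction
open scoped ArithmeticFunction.Moebius ArithmeticFunction.zeta

namespace Literature.NumberTheory.Sieve

namespace SmoothArcs

/-! ### `∑_{m ∣ n} μ(m) ∏_{p ∣ m} F(p) = ∏_{p ∣ n} (1 − F(p))` -/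

/-- **Möbius over the divisors against a product over prime factors**: for `n ≥ 1` and any `F`,
`∑_{m ∣ n} μ(m) ∏_{p ∣ m} F(p) = ∏_{p ∣ n} (1 − F(p))` (multiplicativity of `m ↦ ∏_{p∣m} F(p)`).
[folklore] -/
theorem sum_divisors_moebius_mul_prodPrimeFactors {n : ℕ} (hn : n ≠ 0) (F : ℕ → ℝ) :
    ∑ m ∈ n.divisors, (μ m : ℝ) * ∏ p ∈ m.primeFactors, F p = ∏ p ∈ n.primeFactors, (1 - F p) := by
  classical
  set f : ArithmeticFunction ℝ := ArithmeticFunction.prodPrimeFactors F with hf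
  have hfm : f.IsMultiplicative := IsMultiplicative.prodPrimeFactors F
  set g : ArithmeticFunction ℝ := (ArithmeticFunction.pmul (μ : ArithmeticFunction ℝ) f) * ζ with hg
  have hgm : g.IsMultiplicative := (isMultiplicative_moebius.intCast.pmul hfm).mul isMultiplicative_zeta.natCast
  -- `g n = ∑_{m ∣ n} μ(m) f(m)`
  have hgn : g n = ∑ m ∈ n.divisors, (μ m : ℝ) * ∏ p ∈ m.primeFactors, F p := by
    rw [hg, coe_mul_zeta_apply]
    refine Finset.sum_congr rfl fun m hm => ?_
    have hm0 : m ≠ 0 := Nat.ne_of_gt (Nat.pos_of_mem_divisors hm)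
    rw [pmul_apply, intCoe_apply, hf, prodPrimeFactors_apply hm0]
  -- `g (p^k) = 1 − F p` for `k ≥ 1`
  have hgpk : ∀ p k : ℕ, p.Prime → 0 < k → g (p ^ k) = 1 - F p := by
    intro p k hp hk
    rw [hg, coe_mul_zeta_apply, Nat.divisors_prime_pow hp, Finset.sum_map]
    simp only [Function.Embedding.coeFn_mk, pmul_apply, intCoe_apply]
    rw [Finset.sum_range_succ', pow_zero]
    have h1 : (μ 1 : ℝ) * f 1 = 1 := by rw [ArithmeticFunction.moebius_apply_one, hfm.map_one]; simp
    rw [h1]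
    -- the terms `j+1 ≥ 2` vanish, the term `j+1 = 1` is `-F p`
    rw [Finset.sum_eq_single 0]
    · rw [zero_add, pow_one, ArithmeticFunction.moebius_apply_prime hp, hf, prodPrimeFactors_apply hp.ne_zero,
        Nat.Prime.primeFactors hp, Finset.prod_singleton]
      push_cast; ring
    · intro j hj hj0
      have : ¬ Squarefree (p ^ (j + 1)) := by
        rw [Nat.squarefree_pow_iff hp.ne_one (by omega)]
        intro h; exact hj0 (by omega)
      rw [ArithmeticFunction.moebius_eq_zero_of_not_squarefree this]; simp
    · intro h; exfalso; exact h (Finset.mem_range.mpr hk)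
  rw [← hgn, hgm.multiplicative_factorization g hn, Finsupp.prod, Nat.support_factorization]
  refine Finset.prod_congr rfl fun p hp => ?_
  exact hgpk p _ (Nat.prime_of_mem_primeFactors hp) (Nat.pos_of_ne_zero (Finsupp.mem_support_iff.mp (by
    rwa [Nat.support_factorization])))

/-- The `+` version: `∑_{m ∣ n} |μ(m)| ∏_{p ∣ m} F(p) = ∏_{p ∣ n} (1 + F(p))`. [folklore] -/
theorem sum_divisors_abs_moebius_mul_prodPrimeFactors {n : ℕ} (hn : n ≠ 0) (F : ℕ → ℝ) :
    ∑ m ∈ n.divisors, |(μ m : ℝ)| * ∏ p ∈ m.primeFactors, F p = ∏ p ∈ n.primeFactors, (1 + F p) := by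
  have h := sum_divisors_moebius_mul_prodPrimeFactors hn (fun p => -F p)
  simp only [sub_neg_eq_add] at h
  rw [← h]
  refine Finset.sum_congr rfl fun m _ => ?_
  by_cases hsq : Squarefree m
  · -- `μ(m) ∏(−F) = (−1)^ω (−1)^ω ∏ F = ∏ F = |μ(m)| ∏ F`
    have hcard : ArithmeticFunction.cardFactors m = m.primeFactors.card := by
      rw [ArithmeticFunction.cardFactors_apply, Nat.primeFactors, List.toFinset_card_of_nodup]
      exact (Nat.squarefree_iff_nodup_primeFactorsList (Squarefree.ne_zero hsq)).mp hsq
    have hμ : (μ m : ℝ) = (-1) ^ m.primeFactors.card := by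
      rw [ArithmeticFunction.moebius_apply_of_squarefree hsq, hcard]; push_cast; ring
    have hneg : ∏ p ∈ m.primeFactors, (-F p) = (-1) ^ m.primeFactors.card * ∏ p ∈ m.primeFactors, F p := by
      rw [← Finset.prod_const, ← Finset.prod_mul_distrib]
      refine Finset.prod_congr rfl fun p _ => by ring
    rw [hμ, hneg, abs_pow, abs_neg, abs_one, one_pow, one_mul, ← mul_assoc, ← mul_pow]
    norm_num
  · rw [ArithmeticFunction.moebius_eq_zero_of_not_squarefree hsq]; simp

/-! ### Squarefree arithmetic -/

/-- For squarefree `m`: `φ(m) = ∏_{p ∣ m} (p − 1)` (in `ℝ`). [folklore] -/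
theorem totient_of_squarefree {m : ℕ} (hm : Squarefree m) :
    (m.totient : ℝ) = ∏ p ∈ m.primeFactors, ((p : ℝ) - 1) := by
  have h := Nat.totient_mul_prod_primeFactors m
  rw [Nat.prod_primeFactors_of_squarefree hm] at h
  have hm0 : m ≠ 0 := Squarefree.ne_zero hm
  have h2 : m.totient = ∏ p ∈ m.primeFactors, (p - 1) := by
    rw [mul_comm] at h
    exact Nat.eq_of_mul_eq_mul_left (Nat.pos_of_ne_zero hm0) h
  rw [h2]
  push_cast
  refine Finset.prod_congr rfl fun p hp => ?_
  rw [Nat.cast_sub (Nat.prime_of_mem_primeFactors hp).one_le]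
  simp

/-- For squarefree `m`: `m^s = ∏_{p ∣ m} p^s` (real `s`). [folklore] -/
theorem rpow_of_squarefree {m : ℕ} (hm : Squarefree m) (s : ℝ) :
    (m : ℝ) ^ s = ∏ p ∈ m.primeFactors, (p : ℝ) ^ s := by
  conv_lhs => rw [← Nat.prod_primeFactors_of_squarefree hm]
  push_cast
  exact (Real.finsetProd_rpow _ _ (fun p _ => Nat.cast_nonneg p) s).symm

/-! ### The local factors -/

/-- `G_α(q) = ∑_{g ∣ q} ∑_{d ∣ q/g} μ(q/g) μ(d) (gd)^{−α}/φ(q/g)`. [cite: Harper2016, §2.2] -/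
def localG (α : ℝ) (q : ℕ) : ℝ :=
  ∑ g ∈ q.divisors, ∑ d ∈ (q / g).divisors,
    (μ (q / g) : ℝ) * (μ d : ℝ) * ((g * d : ℕ) : ℝ) ^ (-α) / ((q / g).totient : ℝ)

/-- `H_α(q) = ∑_{g ∣ q} ∑_{d ∣ q/g} |μ(q/g) μ(d)| (gd)^{−α}/φ(q/g)`. [cite: Harper2016, §2.2] -/
def localH (α : ℝ) (q : ℕ) : ℝ :=
  ∑ g ∈ q.divisors, ∑ d ∈ (q / g).divisors,
    |(μ (q / g) : ℝ)| * |(μ d : ℝ)| * ((g * d : ℕ) : ℝ) ^ (-α) / ((q / g).totient : ℝ)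

/-- The inner Möbius sum `∑_{d ∣ m} μ(d) d^{−α} = ∏_{p ∣ m} (1 − p^{−α})`. [folklore] -/
theorem sum_divisors_moebius_rpow {m : ℕ} (hm : m ≠ 0) (α : ℝ) :
    ∑ d ∈ m.divisors, (μ d : ℝ) * (d : ℝ) ^ (-α) = ∏ p ∈ m.primeFactors, (1 - (p : ℝ) ^ (-α)) := by
  rw [← sum_divisors_moebius_mul_prodPrimeFactors hm]
  refine Finset.sum_congr rfl fun d _ => ?_
  by_cases hsq : Squarefree d
  · rw [rpow_of_squarefree hsq]
  · rw [ArithmeticFunction.moebius_eq_zero_of_not_squarefree hsq]; simp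

/-- `∑_{d ∣ m} |μ(d)| d^{−α} = ∏_{p ∣ m} (1 + p^{−α})`. [folklore] -/
theorem sum_divisors_abs_moebius_rpow {m : ℕ} (hm : m ≠ 0) (α : ℝ) :
    ∑ d ∈ m.divisors, |(μ d : ℝ)| * (d : ℝ) ^ (-α) = ∏ p ∈ m.primeFactors, (1 + (p : ℝ) ^ (-α)) := by
  rw [← sum_divisors_abs_moebius_mul_prodPrimeFactors hm]
  refine Finset.sum_congr rfl fun d _ => ?_
  by_cases hsq : Squarefree d
  · rw [rpow_of_squarefree hsq]
  · rw [ArithmeticFunction.moebius_eq_zero_of_not_squarefree hsq]; simp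

/-- Reindexing `g ↦ m = q/g`: `G_α(q) = q^{−α} ∑_{m ∣ q} μ(m) m^{α}/φ(m) ∑_{d ∣ m} μ(d) d^{−α}`. [folklore] -/
theorem localG_eq_sum (α : ℝ) {q : ℕ} (hq : q ≠ 0) :
    localG α q = (q : ℝ) ^ (-α) * ∑ m ∈ q.divisors,
      (μ m : ℝ) * (m : ℝ) ^ α / (m.totient : ℝ) * ∑ d ∈ m.divisors, (μ d : ℝ) * (d : ℝ) ^ (-α) := by
  unfold localG
  set f : ℕ → ℝ := fun m => ∑ d ∈ m.divisors,
      (μ m : ℝ) * (μ d : ℝ) * (((q / m) * d : ℕ) : ℝ) ^ (-α) / (m.totient : ℝ) with hf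
  have h1 : ∑ g ∈ q.divisors, ∑ d ∈ (q / g).divisors,
      (μ (q / g) : ℝ) * (μ d : ℝ) * ((g * d : ℕ) : ℝ) ^ (-α) / ((q / g).totient : ℝ) =
      ∑ g ∈ q.divisors, f (q / g) := by
    refine Finset.sum_congr rfl fun g hg => ?_
    have hgq : g ∣ q := Nat.dvd_of_mem_divisors hg
    simp only [hf]
    rw [Nat.div_div_self hgq hq]
  rw [h1, Nat.sum_div_divisors q f, Finset.mul_sum]
  refine Finset.sum_congr rfl fun m hm => ?_
  have hmq : m ∣ q := Nat.dvd_of_mem_divisors hm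
  have hm0 : 0 < m := Nat.pos_of_mem_divisors hm
  simp only [hf]
  rw [Finset.mul_sum, Finset.mul_sum]
  refine Finset.sum_congr rfl fun d hd => ?_
  have hd0 : 0 < d := Nat.pos_of_mem_divisors hd
  have hq0 : (0 : ℝ) < q := by exact_mod_cast Nat.pos_of_ne_zero hq
  obtain ⟨k, hk⟩ := hmq
  have hk0 : 0 < k := Nat.pos_of_ne_zero (by rintro rfl; simp [hk] at hq)
  have hqmk : q / m = k := by rw [hk, Nat.mul_div_cancel_left k hm0]
  rw [hqmk]
  have hm0' : (0 : ℝ) < m := by exact_mod_cast hm0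
  have hk0' : (0 : ℝ) < k := by exact_mod_cast hk0
  -- `(k d)^{-α} = q^{-α} m^{α} d^{-α}` since `q = m k`
  have e1 : ((k * d : ℕ) : ℝ) ^ (-α) = (q : ℝ) ^ (-α) * (m : ℝ) ^ α * (d : ℝ) ^ (-α) := by
    rw [hk]; push_cast
    rw [Real.mul_rpow (by positivity) (by positivity), Real.mul_rpow (by positivity) (by positivity),
      Real.rpow_neg hm0'.le]
    field_simp
  rw [e1]; ring

/-- **`G_α(q) = q^{−α} ∏_{p ∣ q} (p − p^α)/(p − 1)`** (`q ≥ 1`). [cite: Harper2016, §2.2] -/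
theorem localG_eq_prod (α : ℝ) {q : ℕ} (hq : q ≠ 0) :
    localG α q = (q : ℝ) ^ (-α) * ∏ p ∈ q.primeFactors, (((p : ℝ) - (p : ℝ) ^ α) / ((p : ℝ) - 1)) := by
  rw [localG_eq_sum α hq]
  congr 1
  -- rewrite each summand as `μ(m) ∏_{p ∣ m} (p^α − 1)/(p − 1)` and apply the Möbius identity
  have hsummand : ∀ m ∈ q.divisors, (μ m : ℝ) * (m : ℝ) ^ α / (m.totient : ℝ) * ∑ d ∈ m.divisors, (μ d : ℝ) * (d : ℝ) ^ (-α) =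
      (μ m : ℝ) * ∏ p ∈ m.primeFactors, (((p : ℝ) ^ α - 1) / ((p : ℝ) - 1)) := by
    intro m hm
    have hm0 : m ≠ 0 := Nat.ne_of_gt (Nat.pos_of_mem_divisors hm)
    by_cases hsq : Squarefree m
    · rw [sum_divisors_moebius_rpow hm0, totient_of_squarefree hsq, rpow_of_squarefree hsq,
        mul_div_assoc, mul_assoc]
      congr 1
      rw [div_mul_eq_mul_div, ← Finset.prod_mul_distrib, ← Finset.prod_div_distrib]
      refine Finset.prod_congr rfl fun p hp => ?_
      have hp := Nat.prime_of_mem_primeFactors hp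
      have hp0 : (0 : ℝ) < p := by exact_mod_cast hp.pos
      rw [Real.rpow_neg hp0.le]
      field_simp
    · rw [ArithmeticFunction.moebius_eq_zero_of_not_squarefree hsq]; simp
  rw [Finset.sum_congr rfl hsummand, sum_divisors_moebius_mul_prodPrimeFactors hq]
  refine Finset.prod_congr rfl fun p hp => ?_
  have hp := Nat.prime_of_mem_primeFactors hp
  have hp1 : (1 : ℝ) < p := by exact_mod_cast hp.one_lt
  have hp1' : (p : ℝ) - 1 ≠ 0 := by linarith
  field_simp
  ring

/-- Reindexing for `H`: `H_α(q) = q^{−α} ∑_{m ∣ q} |μ(m)| m^{α}/φ(m) ∑_{d ∣ m} |μ(d)| d^{−α}`. [folklore] -/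
theorem localH_eq_sum (α : ℝ) {q : ℕ} (hq : q ≠ 0) :
    localH α q = (q : ℝ) ^ (-α) * ∑ m ∈ q.divisors,
      |(μ m : ℝ)| * (m : ℝ) ^ α / (m.totient : ℝ) * ∑ d ∈ m.divisors, |(μ d : ℝ)| * (d : ℝ) ^ (-α) := by
  unfold localH
  set f : ℕ → ℝ := fun m => ∑ d ∈ m.divisors,
      |(μ m : ℝ)| * |(μ d : ℝ)| * (((q / m) * d : ℕ) : ℝ) ^ (-α) / (m.totient : ℝ) with hf
  have h1 : ∑ g ∈ q.divisors, ∑ d ∈ (q / g).divisors,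
      |(μ (q / g) : ℝ)| * |(μ d : ℝ)| * ((g * d : ℕ) : ℝ) ^ (-α) / ((q / g).totient : ℝ) =
      ∑ g ∈ q.divisors, f (q / g) := by
    refine Finset.sum_congr rfl fun g hg => ?_
    have hgq : g ∣ q := Nat.dvd_of_mem_divisors hg
    simp only [hf]
    rw [Nat.div_div_self hgq hq]
  rw [h1, Nat.sum_div_divisors q f, Finset.mul_sum]
  refine Finset.sum_congr rfl fun m hm => ?_
  have hmq : m ∣ q := Nat.dvd_of_mem_divisors hm
  have hm0 : 0 < m := Nat.pos_of_mem_divisors hm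
  simp only [hf]
  rw [Finset.mul_sum, Finset.mul_sum]
  refine Finset.sum_congr rfl fun d hd => ?_
  have hd0 : 0 < d := Nat.pos_of_mem_divisors hd
  have hq0 : (0 : ℝ) < q := by exact_mod_cast Nat.pos_of_ne_zero hq
  obtain ⟨k, hk⟩ := hmq
  have hk0 : 0 < k := Nat.pos_of_ne_zero (by rintro rfl; simp [hk] at hq)
  have hqmk : q / m = k := by rw [hk, Nat.mul_div_cancel_left k hm0]
  rw [hqmk]
  have hm0' : (0 : ℝ) < m := by exact_mod_cast hm0
  have hk0' : (0 : ℝ) < k := by exact_mod_cast hk0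
  have e1 : ((k * d : ℕ) : ℝ) ^ (-α) = (q : ℝ) ^ (-α) * (m : ℝ) ^ α * (d : ℝ) ^ (-α) := by
    rw [hk]; push_cast
    rw [Real.mul_rpow (by positivity) (by positivity), Real.mul_rpow (by positivity) (by positivity),
      Real.rpow_neg hm0'.le]
    field_simp
  rw [e1]; ring

/-- **`H_α(q) = q^{−α} ∏_{p ∣ q} (p + p^α)/(p − 1)`** (`q ≥ 1`). [cite: Harper2016, §2.2] -/
theorem localH_eq_prod (α : ℝ) {q : ℕ} (hq : q ≠ 0) :
    localH α q = (q : ℝ) ^ (-α) * ∏ p ∈ q.primeFactors, (((p : ℝ) + (p : ℝ) ^ α) / ((p : ℝ) - 1)) := by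
  rw [localH_eq_sum α hq]
  congr 1
  have hsummand : ∀ m ∈ q.divisors, |(μ m : ℝ)| * (m : ℝ) ^ α / (m.totient : ℝ) * ∑ d ∈ m.divisors, |(μ d : ℝ)| * (d : ℝ) ^ (-α) =
      |(μ m : ℝ)| * ∏ p ∈ m.primeFactors, (((p : ℝ) ^ α + 1) / ((p : ℝ) - 1)) := by
    intro m hm
    have hm0 : m ≠ 0 := Nat.ne_of_gt (Nat.pos_of_mem_divisors hm)
    by_cases hsq : Squarefree m
    · rw [sum_divisors_abs_moebius_rpow hm0, totient_of_squarefree hsq, rpow_of_squarefree hsq,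
        mul_div_assoc, mul_assoc]
      congr 1
      rw [div_mul_eq_mul_div, ← Finset.prod_mul_distrib, ← Finset.prod_div_distrib]
      refine Finset.prod_congr rfl fun p hp => ?_
      have hp := Nat.prime_of_mem_primeFactors hp
      have hp0 : (0 : ℝ) < p := by exact_mod_cast hp.pos
      rw [Real.rpow_neg hp0.le]
      field_simp
    · rw [ArithmeticFunction.moebius_eq_zero_of_not_squarefree hsq]; simp
  rw [Finset.sum_congr rfl hsummand, sum_divisors_abs_moebius_mul_prodPrimeFactors hq]
  refine Finset.prod_congr rfl fun p hp => ?_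
  have hp := Nat.prime_of_mem_primeFactors hp
  have hp1 : (1 : ℝ) < p := by exact_mod_cast hp.one_lt
  have hp1' : (p : ℝ) - 1 ≠ 0 := by linarith
  field_simp
  ring

/-! ### Bounds -/

/-- `0 ≤ (p − p^α)/(p − 1) ≤ 2(1 − α) log p` for `p ≥ 2`, `α ≤ 1`. [folklore] -/
theorem local_prime_factor_bounds {p : ℕ} (hp : 2 ≤ p) {α : ℝ} (hα1 : α ≤ 1) :
    0 ≤ ((p : ℝ) - (p : ℝ) ^ α) / ((p : ℝ) - 1) ∧
    ((p : ℝ) - (p : ℝ) ^ α) / ((p : ℝ) - 1) ≤ 2 * (1 - α) * Real.log p := by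
  have hp2 : (2 : ℝ) ≤ p := by exact_mod_cast hp
  have hp0 : (0 : ℝ) < p := by linarith
  have hp1 : (0 : ℝ) < p - 1 := by linarith
  have hpa : (p : ℝ) ^ α ≤ p := by
    calc (p : ℝ) ^ α ≤ (p : ℝ) ^ (1 : ℝ) := Real.rpow_le_rpow_of_exponent_le (by linarith) hα1
      _ = p := Real.rpow_one _
  constructor
  · exact div_nonneg (by linarith) hp1.le
  · -- `p − p^α = p (1 − e^{−(1−α) log p}) ≤ p (1−α) log p`, and `p/(p−1) ≤ 2`
    have hlog : 0 ≤ Real.log p := Real.log_nonneg (by linarith)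
    have h1 : (p : ℝ) - (p : ℝ) ^ α ≤ p * ((1 - α) * Real.log p) := by
      have h2 : (p : ℝ) ^ α = p * Real.exp (-((1 - α) * Real.log p)) := by
        rw [Real.rpow_def_of_pos hp0, show Real.log p * α = Real.log p + -((1 - α) * Real.log p) by ring,
          Real.exp_add, Real.exp_log hp0]
      rw [h2]
      have h3 : 1 - (1 - α) * Real.log p ≤ Real.exp (-((1 - α) * Real.log p)) := by
        have := Real.add_one_le_exp (-((1 - α) * Real.log p)); linarith
      nlinarith
    rw [div_le_iff₀ hp1]
    have h4 : 0 ≤ (1 - α) * Real.log p := by nlinarith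
    nlinarith

/-- `0 ≤ (p + p^α)/(p − 1) ≤ 4` for `p ≥ 2`, `α ≤ 1`. [folklore] -/
theorem local_prime_factor_abs_bounds {p : ℕ} (hp : 2 ≤ p) {α : ℝ} (hα1 : α ≤ 1) :
    0 ≤ ((p : ℝ) + (p : ℝ) ^ α) / ((p : ℝ) - 1) ∧ ((p : ℝ) + (p : ℝ) ^ α) / ((p : ℝ) - 1) ≤ 4 := by
  have hp2 : (2 : ℝ) ≤ p := by exact_mod_cast hp
  have hp1 : (0 : ℝ) < p - 1 := by linarith
  have hpa : (p : ℝ) ^ α ≤ p := by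
    calc (p : ℝ) ^ α ≤ (p : ℝ) ^ (1 : ℝ) := Real.rpow_le_rpow_of_exponent_le (by linarith) hα1
      _ = p := Real.rpow_one _
  have hpa0 : 0 ≤ (p : ℝ) ^ α := by positivity
  constructor
  · positivity
  · rw [div_le_iff₀ hp1]; nlinarith

/-- **`0 ≤ G_α(q) ≤ q^{−α} ∏_{p ∣ q} 2(1−α) log p`** for `α ≤ 1`, `q ≥ 1`. [cite: Harper2016, §2.2] -/
theorem localG_bounds {α : ℝ} (hα1 : α ≤ 1) {q : ℕ} (hq : q ≠ 0) :
    0 ≤ localG α q ∧ localG α q ≤ (q : ℝ) ^ (-α) * ∏ p ∈ q.primeFactors, (2 * (1 - α) * Real.log p) := by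
  rw [localG_eq_prod α hq]
  have hq0 : (0 : ℝ) < q := by exact_mod_cast Nat.pos_of_ne_zero hq
  have hqa : 0 < (q : ℝ) ^ (-α) := Real.rpow_pos_of_pos hq0 _
  have hfac : ∀ p ∈ q.primeFactors, 0 ≤ ((p : ℝ) - (p : ℝ) ^ α) / ((p : ℝ) - 1) ∧
      ((p : ℝ) - (p : ℝ) ^ α) / ((p : ℝ) - 1) ≤ 2 * (1 - α) * Real.log p :=
    fun p hp => local_prime_factor_bounds (Nat.prime_of_mem_primeFactors hp).two_le hα1
  constructor
  · exact mul_nonneg hqa.le (Finset.prod_nonneg fun p hp => (hfac p hp).1)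
  · exact mul_le_mul_of_nonneg_left (Finset.prod_le_prod (fun p hp => (hfac p hp).1) fun p hp => (hfac p hp).2) hqa.le

/-- **`0 ≤ H_α(q) ≤ 4^{ω(q)} q^{−α}`** for `α ≤ 1`, `q ≥ 1`. [cite: Harper2016, §2.2] -/
theorem localH_bounds {α : ℝ} (hα1 : α ≤ 1) {q : ℕ} (hq : q ≠ 0) :
    0 ≤ localH α q ∧ localH α q ≤ (q : ℝ) ^ (-α) * 4 ^ q.primeFactors.card := by
  rw [localH_eq_prod α hq]
  have hq0 : (0 : ℝ) < q := by exact_mod_cast Nat.pos_of_ne_zero hq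
  have hqa : 0 < (q : ℝ) ^ (-α) := Real.rpow_pos_of_pos hq0 _
  have hfac : ∀ p ∈ q.primeFactors, 0 ≤ ((p : ℝ) + (p : ℝ) ^ α) / ((p : ℝ) - 1) ∧
      ((p : ℝ) + (p : ℝ) ^ α) / ((p : ℝ) - 1) ≤ 4 :=
    fun p hp => local_prime_factor_abs_bounds (Nat.prime_of_mem_primeFactors hp).two_le hα1
  constructor
  · exact mul_nonneg hqa.le (Finset.prod_nonneg fun p hp => (hfac p hp).1)
  · refine mul_le_mul_of_nonneg_left ?_ hqa.le
    calc ∏ p ∈ q.primeFactors, ((p : ℝ) + (p : ℝ) ^ α) / ((p : ℝ) - 1) ≤ ∏ p ∈ q.primeFactors, (4 : ℝ) :=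
          Finset.prod_le_prod (fun p hp => (hfac p hp).1) fun p hp => (hfac p hp).2
      _ = 4 ^ q.primeFactors.card := Finset.prod_const _

/-- `G_α(1) = 1`, `H_α(1) = 1`. [folklore] -/
theorem localG_one (α : ℝ) : localG α 1 = 1 := by
  simp [localG]

/-- `H_α(1) = 1`. [folklore] -/
theorem localH_one (α : ℝ) : localH α 1 = 1 := by
  simp [localH]

end SmoothArcs

end Literature.NumberTheory.Sieve

end
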